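import Mathlib
import Summits.RiemannHypothesis.RiemannHypothesis.Theorems.WeilFarFloorArchBudget
import Summits.RiemannHypothesis.RiemannHypothesis.Theorems.WeilFarFloorCoshTest
import HarnessLib

/-!
# Scalar budgets for the C-XIII″ assembly at the scale `h = s = e^{−2a}` (RH-free)

Helper file (`--supports stmt-RiemannHypothesis-0098`, lead-track anchor: Weil-positivity window ladder, format-C far bound),
pure proofs, RH-free real analysis.  Seat rh-explicit-weil-1 gen13 (memo `run/shared/lean/pub/rh-explicit/rh-explicit-weil-1/FORMAT-K3.md` §14).
The eventual forms of C-XIII″ (`WeilFarFloorCoshOptimalRH`, `WeilFarFloorCoshOptimalRateBoundRH`) discharge the abstract budgets of their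
class/floor theorems at `h = s = e^{−2a}`, `b = a + h`; this file holds the RH-free inequalities used there:
* `sinh_lower` (`sinh a ≥ e^a/4`, `≥ a/2 + a²/4`, `a ≥ 1`), `weightSum_mono`, `coshQuotient_le_farCoercivityFloor` (the cosh test is a competitor);
* `eight_archTail_le_of_large` : `8Ψ(ηe^{−2a}/2) ≤ (a + e^{−2a}) + sinh(a + e^{−2a})` once `a ≥ 90 + 16 log(2/η)` (`Ψ = weilArchTail`,
  `weilArchTail_le_half_log`);
* `weightSum_budget_of_large` : `6·38(e^{b+1} + 1)·e^{−2a} ≤ η` once `456e²e^{−a} ≤ η`;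
* `residual_budget_of_large` : the residual condition `hS2` of `WeilFarFloorCoshOptimalCoreRH` once
  `(4(2C_q + 2I + 3) + 5)(4K₁ + 10·154²e⁴ + 32e² + 12 + 2log(2/η))·(a+2)⁸e^{−a} ≤ η²`.
Standard axioms only.
-/

set_option linter.dupNamespace false
set_option autoImplicit false

noncomputable section

open MeasureTheory Set Filter
open scoped Real Topology ArithmeticFunction.vonMangoldt

namespace Summit.RiemannHypothesis.RiemannHypothesis.Theorems.WeilFormatC

namespace FloorCoshSplit

open Literature.NumberTheory.LFunctions FloorCosh FloorEnvelope

/-! ## §1 Elementary sizes -/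

/-- `sinh a ≥ e^a/4` and `sinh a ≥ a/2 + a²/4` for `a ≥ 1`. -/
theorem sinh_lower {a : ℝ} (ha : 1 ≤ a) : Real.exp a / 4 ≤ Real.sinh a ∧ a / 2 + a ^ 2 / 4 ≤ Real.sinh a := by
  rw [Real.sinh_eq]
  have h1 := Real.quadratic_le_exp_of_nonneg (by linarith : (0 : ℝ) ≤ a)
  have h2 : Real.exp (-a) ≤ 1 := Real.exp_le_one_iff.2 (by linarith)
  have h3 : Real.exp (-a) * Real.exp a = 1 := by rw [← Real.exp_add]; simp
  constructor
  · nlinarith [Real.exp_pos (-a), Real.exp_pos a]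
  · nlinarith [Real.exp_pos (-a)]

/-- Monotonicity of the weight sum in the window. -/
theorem weightSum_mono {b b' : ℝ} (hbb : b ≤ b') :
    ∑ n ∈ weilPrimeIndex b, 2 * ((Λ n : ℝ) / Real.sqrt n) ≤ ∑ n ∈ weilPrimeIndex b', 2 * ((Λ n : ℝ) / Real.sqrt n) :=
  Finset.sum_le_sum_of_subset_of_nonneg (fun n hn ↦
    mem_weilPrimeIndex.2 ((mem_weilPrimeIndex.1 hn).trans_le (by linarith))) fun n _ _ ↦
    mul_nonneg (by norm_num) (div_nonneg ArithmeticFunction.vonMangoldt_nonneg (Real.sqrt_nonneg _))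

/-- The trivial direction: the cosh test is a competitor, `Q_a(χ_a)/(a + sinh a) ≤ λ_max(a)` (`a > 0`). -/
theorem coshQuotient_le_farCoercivityFloor {a : ℝ} (ha : 0 < a) :
    primeShiftForm a ((Icc (-a) a).indicator (fun y ↦ Real.cosh (y / 2))) / (a + Real.sinh a) ≤ farCoercivityFloor a := by
  obtain ⟨hm, hb, hs⟩ := coshTest_admissible a
  have hP : 0 < a + Real.sinh a := by have := Real.sinh_pos_iff.2 ha; linarith
  have hnorm := integral_coshTest_sq ha.le
  refine le_csSup (primeShiftQuotients_bddAbove a) ⟨_, Real.cosh (a / 2), hm, hb, hs, by rw [hnorm]; exact hP, ?_⟩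
  rw [hnorm]

/-! ## §2 The three budget conditions -/

/-- The largeness condition: `8Ψ(ηe^{−2a}/2) ≤ (a + e^{−2a}) + sinh(a + e^{−2a})` once `a ≥ 90 + 16 log(2/η)`. -/
theorem eight_archTail_le_of_large {a η : ℝ} (hη0 : 0 < η) (hη1 : η ≤ 1) (ha1 : 1 ≤ a)
    (ha : 90 + 16 * Real.log (2 / η) ≤ a) :
    8 * weilArchTail (η * (Real.exp (-(2 * a)) / 2))
      ≤ (a + Real.exp (-(2 * a))) + Real.sinh (a + Real.exp (-(2 * a))) := by
  set h := Real.exp (-(2 * a)) with hh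
  have hh0 : 0 < h := Real.exp_pos _
  have hh1 : h ≤ 1 := by rw [hh]; exact Real.exp_le_one_iff.2 (by linarith)
  have ht0 : 0 < η * (h / 2) := by positivity
  have ht1 : η * (h / 2) ≤ 1 := by nlinarith
  have h2η : 2 ≤ 2 / η := by rw [le_div_iff₀ hη0]; linarith
  have hL0 : 0 ≤ Real.log (2 / η) := Real.log_nonneg (by linarith)
  have hΨ := weilArchTail_le_half_log ht0 ht1
  have hlog : Real.log (1 / (η * (h / 2))) = Real.log (2 / η) + 2 * a := by
    have e : 1 / (η * (h / 2)) = (2 / η) * Real.exp (2 * a) := by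
      rw [hh, Real.exp_neg]; field_simp
    rw [e, Real.log_mul (by positivity) (Real.exp_pos _).ne', Real.log_exp]
  rw [hlog] at hΨ
  obtain ⟨-, hsinh⟩ := sinh_lower ha1
  have hsinh' : Real.sinh a ≤ Real.sinh (a + h) := Real.sinh_le_sinh.2 (by linarith)
  have hkey : a * (90 + 16 * Real.log (2 / η)) ≤ a * a := mul_le_mul_of_nonneg_left ha (by linarith)
  nlinarith [hΨ, hsinh, hsinh', hkey, hL0, hh0]

/-- The weight-sum condition `hS1`: `6·W·e^{−2a} ≤ η` with `W = 38(e^{b+1} + 1)`, `b = a + e^{−2a}`, once `456e²e^{−a} ≤ η`. -/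
theorem weightSum_budget_of_large {a η : ℝ} (ha0 : 0 ≤ a) (hsmall : 456 * Real.exp 2 * Real.exp (-a) ≤ η) :
    6 * (38 * (Real.exp (a + Real.exp (-(2 * a)) + 1) + 1)) * Real.exp (-(2 * a)) ≤ η := by
  have hh1 : Real.exp (-(2 * a)) ≤ 1 := Real.exp_le_one_iff.2 (by linarith)
  have h1 : Real.exp (a + Real.exp (-(2 * a)) + 1) ≤ Real.exp (a + 2) := Real.exp_le_exp.2 (by linarith)
  have h2 : 1 ≤ Real.exp (a + 2) := Real.one_le_exp (by linarith)
  have h3 : Real.exp (a + 2) * Real.exp (-(2 * a)) = Real.exp 2 * Real.exp (-a) := by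
    rw [← Real.exp_add, ← Real.exp_add]; ring_nf
  nlinarith [Real.exp_pos (-(2 * a)), h3]

/-- The residual condition `hS2` with `h = s = e^{−2a}`, `b = a + h`, `J_c = K₁(b+1)⁵`, `W = 38(e^{b+1}+1)`, `τ = e^{b+1} + b + 1`,
`Γ = 2(b+1) + 2I + C_q((b+1)³ + 1)`, `ρ₀ = (Γ+1)/(b + sinh b) + 5s`, `P₊ = (b+1) + sinh(b+1)`: it holds once
`(4(2C_q + 2I + 3) + 5)·(4K₁ + 10·154²e⁴ + 32e² + 12 + 2log(2/η))·(a+2)⁸e^{−a} ≤ η²` (and `a ≥ 1`). -/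
theorem residual_budget_of_large {a η K₁ Cq I : ℝ} (hη0 : 0 < η) (hη1 : η ≤ 1) (hK : 0 ≤ K₁) (hCq : 0 ≤ Cq) (hI0 : 0 ≤ I)
    (ha1 : 1 ≤ a)
    (hsmall : (4 * (2 * Cq + 2 * I + 3) + 5) * (4 * K₁ + 10 * (154 ^ 2 * Real.exp 4) + 32 * Real.exp 2 + 12
        + 2 * Real.log (2 / η)) * ((a + 2) ^ 8 * Real.exp (-a)) ≤ η ^ 2) :
    ((2 * (a + Real.exp (-(2 * a)) + 1) + 2 * I + Cq * ((a + Real.exp (-(2 * a)) + 1) ^ 3 + 1) + 1)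
        / ((a + Real.exp (-(2 * a))) + Real.sinh (a + Real.exp (-(2 * a)))) + 5 * Real.exp (-(2 * a)))
      * (2 * (2 * (K₁ * (a + Real.exp (-(2 * a)) + 1) ^ 5)
          + 5 * Real.exp (-(2 * a)) ^ 2 * (2 * (38 * (Real.exp (a + Real.exp (-(2 * a)) + 1) + 1))
            + (Real.exp (a + Real.exp (-(2 * a)) + 1) + (a + Real.exp (-(2 * a)) + 1))) ^ 2) / η
        + 16 * Real.exp (-(2 * a)) ^ 2 * ((a + Real.exp (-(2 * a)) + 1) + Real.sinh (a + Real.exp (-(2 * a)) + 1))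
        + 4 * weilArchTail (η * (Real.exp (-(2 * a)) / 2))) ≤ η := by
  -- abbreviations (all opaque from here on)
  set h := Real.exp (-(2 * a)) with hh
  set L := Real.log (2 / η) with hL
  set CΓ := 2 * Cq + 2 * I + 3 with hCΓ
  set CW := 154 ^ 2 * Real.exp 4 with hCW
  set X := a + 2 with hX
  have hCE : 4 * K₁ + 10 * (154 ^ 2 * Real.exp 4) + 32 * Real.exp 2 + 12 + 2 * L = 4 * K₁ + 10 * CW + 32 * Real.exp 2 + 12 + 2 * L := by
    rw [hCW]
  rw [hCE] at hsmall
  set CE := 4 * K₁ + 10 * CW + 32 * Real.exp 2 + 12 + 2 * L with hCEdef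
  have hh0 : 0 < h := by rw [hh]; exact Real.exp_pos _
  have hh1 : h ≤ 1 := by rw [hh]; exact Real.exp_le_one_iff.2 (by linarith only [ha1])
  have hh_ea : h ≤ Real.exp (-a) := by rw [hh]; exact Real.exp_le_exp.2 (by linarith only [ha1])
  have hea : 0 < Real.exp (-a) := Real.exp_pos _
  have hea1 : Real.exp (-a) ≤ 1 := Real.exp_le_one_iff.2 (by linarith only [ha1])
  have heinv : Real.exp (-a) * Real.exp a = 1 := by rw [← Real.exp_add]; simp
  have h2η : 2 ≤ 2 / η := by rw [le_div_iff₀ hη0]; linarith only [hη1]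
  have hL0 : 0 ≤ L := by rw [hL]; exact Real.log_nonneg (by linarith only [h2η])
  have hE2 : 1 ≤ Real.exp 2 := Real.one_le_exp (by norm_num)
  have hCΓ0 : 0 ≤ CΓ := by rw [hCΓ]; positivity
  have hCW0 : 0 ≤ CW := by rw [hCW]; positivity
  have hCE0 : 0 ≤ CE := by rw [hCEdef]; positivity
  set b := a + h with hb
  have hb1 : 1 ≤ b := by rw [hb]; linarith only [ha1, hh0]
  have hbX : b + 1 ≤ X := by rw [hb, hX]; linarith only [hh1]
  have hb10 : 0 ≤ b + 1 := by linarith only [hb1]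
  clear_value h L CΓ CW X CE b
  -- powers of `X`
  have hX3 : 3 ≤ X := by rw [hX]; linarith only [ha1]
  have hX1 : 1 ≤ X := by linarith only [hX3]
  have hX0 : 0 ≤ X := by linarith only [hX3]
  have hX2 : 1 ≤ X ^ 2 := by nlinarith only [hX1]
  have hXp3 : X ≤ X ^ 3 := by nlinarith only [hX2, hX0]
  have hX3_1 : 1 ≤ X ^ 3 := hX1.trans hXp3
  have hXp5 : X ^ 3 ≤ X ^ 5 := by nlinarith only [hX2, hX3_1]
  have hX5_1 : 1 ≤ X ^ 5 := hX3_1.trans hXp5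
  have hX5_a : a ≤ X ^ 5 := by rw [hX] at hXp3 hXp5 ⊢; linarith only [hXp3, hXp5]
  -- (1) `ρ₀ ≤ (4CΓ + 5)·X³·e^{−a}`
  have hbX3 : (b + 1) ^ 3 ≤ X ^ 3 := pow_le_pow_left₀ hb10 hbX 3
  have hΓ1 : 2 * (b + 1) + 2 * I + Cq * ((b + 1) ^ 3 + 1) + 1 ≤ CΓ * X ^ 3 := by
    have h1 := mul_le_mul_of_nonneg_left hbX3 hCq
    have h2 := mul_nonneg hCq (by linarith only [hX3_1] : (0:ℝ) ≤ X ^ 3 - 1)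
    have h3 := mul_nonneg hI0 (by linarith only [hX3_1] : (0:ℝ) ≤ X ^ 3 - 1)
    rw [hCΓ]
    nlinarith only [h1, h2, h3, hbX, hXp3, hX3_1]
  obtain ⟨hsinhE, -⟩ := sinh_lower ha1
  have hP : Real.exp a / 4 ≤ b + Real.sinh b := by
    have : Real.sinh a ≤ Real.sinh b := Real.sinh_le_sinh.2 (by rw [hb]; linarith only [hh0])
    linarith only [this, hsinhE, hb1]
  have hPpos : 0 < Real.exp a / 4 := by positivity
  have hP0 : 0 < b + Real.sinh b := lt_of_lt_of_le hPpos hP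
  have hρ1 : (2 * (b + 1) + 2 * I + Cq * ((b + 1) ^ 3 + 1) + 1) / (b + Real.sinh b) ≤ 4 * CΓ * X ^ 3 * Real.exp (-a) := by
    rw [div_le_iff₀ hP0]
    have h1 : 4 * CΓ * X ^ 3 * Real.exp (-a) * (Real.exp a / 4) = CΓ * X ^ 3 := by
      calc 4 * CΓ * X ^ 3 * Real.exp (-a) * (Real.exp a / 4) = CΓ * X ^ 3 * (Real.exp (-a) * Real.exp a) := by ring
        _ = CΓ * X ^ 3 := by rw [heinv, mul_one]
    have hc0 : 0 ≤ 4 * CΓ * X ^ 3 * Real.exp (-a) := by positivity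
    have h2 := mul_le_mul_of_nonneg_left hP hc0
    linarith only [hΓ1, h1, h2]
  have hρ : (2 * (b + 1) + 2 * I + Cq * ((b + 1) ^ 3 + 1) + 1) / (b + Real.sinh b) + 5 * h
      ≤ (4 * CΓ + 5) * X ^ 3 * Real.exp (-a) := by
    have h1 : h ≤ X ^ 3 * Real.exp (-a) := by nlinarith only [hh_ea, hea, hX3_1]
    nlinarith only [hρ1, h1]
  have hρ0 : 0 ≤ (2 * (b + 1) + 2 * I + Cq * ((b + 1) ^ 3 + 1) + 1) / (b + Real.sinh b) + 5 * h := by positivity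
  -- (2) `E ≤ CE·X⁵/η`
  have hJc : K₁ * (b + 1) ^ 5 ≤ K₁ * X ^ 5 := mul_le_mul_of_nonneg_left (pow_le_pow_left₀ hb10 hbX 5) hK
  have heb : Real.exp (b + 1) ≤ Real.exp X := Real.exp_le_exp.2 hbX
  have heX1 : 1 ≤ Real.exp X := Real.one_le_exp hX0
  have hXe : X ≤ Real.exp X := by linarith only [Real.add_one_le_exp X]
  have hWτ : 2 * (38 * (Real.exp (b + 1) + 1)) + (Real.exp (b + 1) + (b + 1)) ≤ 154 * Real.exp X := by
    linarith only [heb, heX1, hXe, hbX]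
  have hWτ0 : 0 ≤ 2 * (38 * (Real.exp (b + 1) + 1)) + (Real.exp (b + 1) + (b + 1)) := by positivity
  have hsq : h ^ 2 * (2 * (38 * (Real.exp (b + 1) + 1)) + (Real.exp (b + 1) + (b + 1))) ^ 2 ≤ CW := by
    have h1 : (2 * (38 * (Real.exp (b + 1) + 1)) + (Real.exp (b + 1) + (b + 1))) ^ 2 ≤ (154 * Real.exp X) ^ 2 :=
      pow_le_pow_left₀ hWτ0 hWτ 2
    have h3 : h * Real.exp X = Real.exp (2 - a) := by rw [hh, hX, ← Real.exp_add]; ring_nf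
    have h4 : Real.exp (2 - a) ^ 2 ≤ Real.exp 4 := by
      rw [← Real.exp_nat_mul]; exact Real.exp_le_exp.2 (by push_cast; linarith only [ha1])
    calc h ^ 2 * (2 * (38 * (Real.exp (b + 1) + 1)) + (Real.exp (b + 1) + (b + 1))) ^ 2
        ≤ h ^ 2 * (154 * Real.exp X) ^ 2 := mul_le_mul_of_nonneg_left h1 (sq_nonneg _)
      _ = 154 ^ 2 * (h * Real.exp X) ^ 2 := by ring
      _ = 154 ^ 2 * Real.exp (2 - a) ^ 2 := by rw [h3]
      _ ≤ CW := by rw [hCW]; exact mul_le_mul_of_nonneg_left h4 (by norm_num)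
  have hPp : h ^ 2 * ((b + 1) + Real.sinh (b + 1)) ≤ 2 * Real.exp 2 := by
    have h1 : (b + 1) + Real.sinh (b + 1) ≤ 2 * Real.exp X := by
      have e1 : Real.sinh (b + 1) ≤ Real.exp (b + 1) := by
        rw [Real.sinh_eq]; linarith only [Real.exp_pos (-(b + 1)), Real.exp_pos (b + 1)]
      have e2 : b + 1 ≤ Real.exp (b + 1) := by linarith only [Real.add_one_le_exp (b + 1)]
      linarith only [e1, e2, heb]
    have h2 : h ^ 2 * Real.exp X ≤ Real.exp 2 := by
      have e : h ^ 2 * Real.exp X = Real.exp (2 - 3 * a) := by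
        rw [hh, hX, ← Real.exp_nat_mul, ← Real.exp_add]; ring_nf
      rw [e]; exact Real.exp_le_exp.2 (by linarith only [ha1])
    have h3 := mul_le_mul_of_nonneg_left h1 (sq_nonneg h)
    linarith only [h2, h3]
  have hΨ0 : 0 ≤ weilArchTail (η * (h / 2)) := (weilArchTail_pos (by positivity)).le
  have hΨ : weilArchTail (η * (h / 2)) ≤ a + L / 2 + 2 := by
    have ht0 : 0 < η * (h / 2) := by positivity
    have ht1 : η * (h / 2) ≤ 1 := by nlinarith only [hη0, hη1, hh0, hh1]
    have h1 := weilArchTail_le_half_log ht0 ht1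
    have e : 1 / (η * (h / 2)) = (2 / η) * Real.exp (2 * a) := by rw [hh, Real.exp_neg]; field_simp
    rw [e, Real.log_mul (by positivity) (Real.exp_pos _).ne', Real.log_exp, ← hL] at h1
    linarith only [h1]
  have hE : 2 * (2 * (K₁ * (b + 1) ^ 5) + 5 * h ^ 2 * (2 * (38 * (Real.exp (b + 1) + 1))
        + (Real.exp (b + 1) + (b + 1))) ^ 2) / η + 16 * h ^ 2 * ((b + 1) + Real.sinh (b + 1))
        + 4 * weilArchTail (η * (h / 2)) ≤ CE * X ^ 5 / η := by
    have hη' : 1 ≤ 1 / η := by rw [le_div_iff₀ hη0]; linarith only [hη1]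
    -- each term against `X⁵/η`
    have t1 : 2 * (2 * (K₁ * (b + 1) ^ 5) + 5 * h ^ 2 * (2 * (38 * (Real.exp (b + 1) + 1))
        + (Real.exp (b + 1) + (b + 1))) ^ 2) / η ≤ (4 * K₁ + 10 * CW) * X ^ 5 / η := by
      refine div_le_div_of_nonneg_right ?_ hη0.le
      have : 5 * h ^ 2 * (2 * (38 * (Real.exp (b + 1) + 1)) + (Real.exp (b + 1) + (b + 1))) ^ 2 ≤ 5 * CW * X ^ 5 := by
        nlinarith only [hsq, hCW0, hX5_1]
      nlinarith only [hJc, this]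
    have t2 : 16 * h ^ 2 * ((b + 1) + Real.sinh (b + 1)) ≤ (32 * Real.exp 2) * X ^ 5 / η := by
      rw [le_div_iff₀ hη0]
      have := mul_le_mul hPp hη1 hη0.le (by positivity)
      nlinarith only [this, hX5_1, hE2, hη0, hPp]
    have t3 : 4 * weilArchTail (η * (h / 2)) ≤ (12 + 2 * L) * X ^ 5 / η := by
      rw [le_div_iff₀ hη0]
      have := mul_le_mul hΨ hη1 hη0.le (by positivity)
      nlinarith only [this, hX5_1, hX5_a, hL0, hΨ0, hη0, hη1]
    have e : CE * X ^ 5 / η = (4 * K₁ + 10 * CW) * X ^ 5 / η + (32 * Real.exp 2) * X ^ 5 / η + (12 + 2 * L) * X ^ 5 / η := by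
      rw [hCEdef]; ring
    rw [e]; linarith only [t1, t2, t3]
  have hPp0 : 0 ≤ (b + 1) + Real.sinh (b + 1) := by
    have := Real.sinh_nonneg_iff.2 hb10; linarith only [this, hb10]
  have hE0 : 0 ≤ 2 * (2 * (K₁ * (b + 1) ^ 5) + 5 * h ^ 2 * (2 * (38 * (Real.exp (b + 1) + 1))
        + (Real.exp (b + 1) + (b + 1))) ^ 2) / η + 16 * h ^ 2 * ((b + 1) + Real.sinh (b + 1))
        + 4 * weilArchTail (η * (h / 2)) := by positivity
  -- (3) the product
  have hprod := mul_le_mul hρ hE hE0 (by positivity)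
  refine hprod.trans ?_
  rw [show (4 * CΓ + 5) * X ^ 3 * Real.exp (-a) * (CE * X ^ 5 / η)
      = ((4 * CΓ + 5) * CE * (X ^ 8 * Real.exp (-a))) / η by ring, div_le_iff₀ hη0]
  have e2 : η ^ 2 = η * η := by ring
  linarith only [hsmall, e2]

end FloorCoshSplit

end Summit.RiemannHypothesis.RiemannHypothesis.Theorems.WeilFormatC
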